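import Literature.NumberTheory.LFunctions.RodgersTaoZeroContinuity
import Mathlib.Analysis.Calculus.ContDiff.Defs
import Mathlib.MeasureTheory.Integral.IntervalIntegral.Basic
import HarnessLib

/-!
# Rodgers–Tao 2020, §4 "Dynamics of zeros": Theorem 4.1 (the ODE) and Lemma 4.2 (identities)

RH-FREE LITERATURE (typed statements, as printed, with page locators). Trunk T-ANT
(`Literature/NumberTheory/LFunctions`). B. Rodgers, T. Tao, *The de Bruijn–Newman constant is
non-negative*, Forum Math. Pi 8 (2020) e6 = arXiv:1801.05914, **§4**. Version pinned: the
statements below were typed from the authors' arXiv **v5** TeX (§4 = `\section{Dynamics of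
zeroes}`, Theorem `dynam`, Lemma `ident`) and checked against the published text, Forum Math.
Pi 8 (2020) e6, **p. 27** (Theorem 11 = arXiv v4 Theorem 4.1, display (56)) and **pp. 29–30**
(Lemma 12 = arXiv v4 Lemma 4.2, items (i)–(v); displays (57) `H_{jk}`, (58) `E_{kk'}` on p. 29;
proof pp. 31–33). Numbering: v4 "Thm. 4.1 / Lemma 4.2" = v5/FMP "Thm. 11 / Lemma 12"; the
statements are identical in v4, v5 and FMP (arXiv v1/v2 print the typo "`−Λ < t ≤ 0`" in
Thm. 4.1, corrected to "`Λ < t ≤ 0`" from v3 on). Nothing in this file bears on the truth of the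
Riemann hypothesis: it records which statements §4 of the source prints.

## What the source prints (FMP p. 27, pp. 29–30)

> **Theorem 11** (Dynamics of zeros). For `Λ < t ≤ 0`, the zeros `x_j(t)` depend in a
> continuously differentiable fashion on `t` for each `j`, with the equations of motion
> `∂ₜ x_k(t) = 2 Σ'_{j : j ≠ k} 1/(x_k(t) − x_j(t))`  (56)
> for `k ∈ ℤ*` and `Λ < t ≤ 0`, where the tick denotes principal value summation over `j ∈ ℤ*`
> (which will converge thanks to (50) and (43)). *Proof.* This follows from [CSV, Lemma 2.4]
> (the continuity of the derivative following for instance from [CSV, Lemma 2.1]).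
>
> `H_{jk}(t) := log (1/|x_j(t) − x_k(t)|)` (57), `E_{kk'}(t) := 1/|x_k(t) − x_{k'}(t)|²` (58).
>
> **Lemma 12** (Identities). For brevity, we suppress explicit dependence on the time parameter
> `t ∈ (Λ, 0]`. Let `K ⊂ ℤ*` be a finite set of some cardinality `|K|`. All summation indices
> such as `i, j, k` are assumed to lie in `ℤ*`.
> (i) (Dynamics of a gap, cf. [CSV, Lemma 2.4]) If `j, k ∈ ℤ*` are distinct, then
>   `∂ₜ(x_k − x_j) = 4/(x_k − x_j) − 2(x_k − x_j) Σ_{i : i ≠ k,j} 1/((x_i − x_k)(x_i − x_j))`.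
> (ii) (Cross-energy inequality, cf. [CSV, Lemma 2.5])
>   `∂ₜ Σ_{k ∈ K; j ∉ K} E_{jk} ≥ −Σ_{k ∈ K; j ∉ K} 8/(x_k − x_j)⁴` in the weak sense that
>   `Σ_{k ∈ K; j ∉ K} E_{jk}(t₂) − E_{jk}(t₁) ≥ −∫_{t₁}^{t₂} Σ_{k ∈ K; j ∉ K} 8/(x_k − x_j)⁴ (t) dt`
>   whenever `Λ < t₁ < t₂ ≤ 0`.
> (iii) (Energy identity)
>   `∂ₜ Σ_{k,k' ∈ K : k ≠ k'} E_{kk'} = Σ_{j ∉ K; k,k' ∈ K : k ≠ k'} 4/((x_k − x_{k'})²(x_k − x_j)(x_{k'} − x_j))`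
>   `− 2 Σ_{k,k' ∈ K : k ≠ k'} (2/(x_k − x_{k'})² − Σ_{k'' ∈ K : k'' ≠ k,k'} 1/((x_{k''} − x_k)(x_{k''} − x_{k'})))²`.
> (iv) (Virial identity)
>   `∂ₜ Σ_{k,k' ∈ K : k ≠ k'} (x_k − x_{k'})² = 4|K|²(|K| − 1) − Σ_{k,k' ∈ K : k ≠ k'} (x_k − x_{k'})² Σ_{j ∉ K} 4/((x_k − x_j)(x_{k'} − x_j))`.
> (v) (Hamiltonian identity)
>   `∂ₜ Σ_{k,k' ∈ K : k ≠ k'} H_{kk'} = −4 Σ_{k,k' ∈ K : k ≠ k'} E_{kk'} + 2 Σ_{j ∉ K; k,k' ∈ K : k ≠ k'} 1/((x_j − x_k)(x_j − x_{k'}))`.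

## Contents (source item → declaration → status)

Definitions (real bodies; namespace `Literature.NumberTheory.LFunctions`):

* §1.2 `(x_j(t))_{j ∈ ℤ*}`, `x_{−j} = −x_j` → `deBruijnZeroZ t j` (`j : ℤ`), the odd extension of
  the tree's `deBruijnZero t j` (`j : ℕ`); API `deBruijnZeroZ_natCast`, `deBruijnZeroZ_neg`,
  `strictMono_deBruijnZeroZ`, `deBruijnH_deBruijnZeroZ`, `exists_deBruijnZeroZ_eq`,
  `continuousAt_deBruijnZeroZ`, `deriv_deBruijnH_deBruijnZeroZ_ne_zero` (all PROVED, from the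
  cited tree theorems);
* §1.2 `[j₋, j₊]_{ℤ*}` → `zstarIcc a b`; `ℤ* ∖ K` → `zstarCompl K`;
* §1.2/(56) `Σ'_{j ≠ k} 1/(x_k − x_j)` → partial sums `zeroVelocityPartialSum t k J` and their
  principal value `zeroVelocitySum t k` (`limUnder`);
* (58) `E_{jk}` → `interactionEnergy t j k`; (57) `H_{jk}` → `hamiltonianInteraction t j k`;
* the environment coupling `Σ_{j ∉ K} 1/((x_j − x_k)(x_j − x_{k'}))` of Lemma 12 →
  `rodgersTaoCrossTerm`, `rodgersTaoCrossSum t K k k'`.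

Named facts (D-0014; unproved here — the genuine §4 content; discharges go to the companion
file `RodgersTaoZeroDynamicsProofs.lean`):

* Thm. 4.1 = Thm. 11 → `rodgers_tao_zero_dynamics`;
* Lemma 4.2 = Lemma 12 (i) → `rodgers_tao_gap_dynamics`;
  (ii) → `rodgers_tao_cross_energy_inequality`; (iii) → `rodgers_tao_energy_identity`;
  (iv) → `rodgers_tao_virial_identity`; (v) → `rodgers_tao_hamiltonian_identity`.

## Cited, not restated (tree theorems this section leans on)

The CONTINUITY-and-ORDERING half of Thm. 4.1 is already proved in the tree for every `t > Λ`: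
`continuousAt_deBruijnZero`, `continuousOn_deBruijnZero`, `rodgers_tao_zeros_ordered`,
`rodgers_tao_zeros_continuousOn` (`RodgersTaoZeroContinuity.lean`), with the tools
`zero_unique_of_deriv_ne_zero`, `exists_zero_of_re_mul_re_neg`,
`eventually_forall_ne_zero_of_isCompact`; the zero enumeration `deBruijnZero`,
`strictMono_deBruijnZero`, `deBruijnH_deBruijnZero`, `exists_deBruijnZero_eq`,
`deriv_deBruijnH_deBruijnZero_ne_zero` (simplicity = Csordas–Smith–Varga Thm. 2.2,
`csordasSmithVarga_simple_zeros_holds`) (`RodgersTaoZeroSet.lean`); the backwards heat equation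
`∂ₜ H_t = −H_t''` is `hasDerivAt_deBruijnH_time` / `hasDerivAt_deBruijnH_time'` and the joint
continuity of `H_t`, `H_t'`, `H_t''` in `(t, z)` is `continuous_deBruijnH_uncurry`,
`continuous_deriv_deBruijnH_uncurry`, `continuous_deriv_deriv_deBruijnH_uncurry`
(`DeBruijnHHeatFlow.lean`); the grouped Hadamard product `H_t(z) = H_t(0) ∏ (1 + b_n z²)` and
`H_t'/H_t = Σ 2 b_n z/(1 + b_n z²)` are `exists_isHadamardSeq`, `IsHadamardSeq.logDeriv_eq`,
`IsHadamardSeq.logDeriv_cofactor_self` (`DeBruijnHLogDerivSeries.lean`). These are exactly the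
inputs of the printed derivation (implicit differentiation of `H_t(x_k(t)) = 0` with
`∂ₜ H = −H''`, and `H_t''(x_k)/H_t'(x_k) = 2 Σ'_{j ≠ k} 1/(x_k − x_j)` from the Hadamard product),
so the facts below are dischargeable from tree material. The finite-configuration velocity field
`ż_k = 2 Σ_{j ≠ k} (z_k − z_j)⁻¹` of the summit-side bookkeeping file
`Theorems/DBNZeroDynamics.lean` is a different (finite) object and is not used.

## Typed range and divergences (rt/README §0.4 = referee F1b; RT Remark 2.2)

Printed ranges: Thm. 11 "`Λ < t ≤ 0`", Lemma 12 "`t ∈ (Λ, 0]`", (ii) "`Λ < t₁ < t₂ ≤ 0`". Typed: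
every `t` (resp. `t₁`) **above `Λ`** in the tree's `sInf`-free form
`∃ t₁ < t, HasOnlyRealZeros (deBruijnH t₁)` (as in the tree's continuity half of Thm. 4.1), with
the upper limit `t ≤ 0` dropped: the printed derivation uses only that the zeros of `H_t` are
real and simple (true for all `t > Λ`: `hasOnlyRealZeros_of_exists_lt`,
`csordasSmithVarga_simple_zeros_holds`) and the Hadamard product / heat equation (every real
`t`); `t ≤ 0` is the paper's standing range (§1.2), not an input. Rendered literally over
`deBruijnNewmanConst` the printed strict range would be EMPTY (tree theorem `Λ ≥ 0`,
`rodgers_tao_holds`), which is not the printed content. Other rendering choices, each recorded in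
the docstring of the declaration concerned: "continuously differentiable" = `ContDiffAt ℝ 1` at
every `t > Λ`; "`Σ'` converges" = `Tendsto` of the partial sums over `[−J, J]_{ℤ*} ∖ {k}`;
"`∂ₜ F = G`" = `HasDerivAt F G t`; the absolutely convergent sums over `i ≠ k, j` / `j ∉ K` are
`tsum`s over the subtype `zstarCompl _` **together with** an explicit `Summable` clause (the
source: "the series is now absolutely convergent thanks to (50), (43)"), so that no `tsum` in a
fact carries a junk value; in (ii) the interval integral is accompanied by the
`IntervalIntegrable` clause that the source's monotone-convergence proof (p. 31) implicitly
provides. Ordered pairs `k ≠ k'` in `K` are `K.offDiag`, as in `renormEnergyOn`.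

## Junk conventions

`x_0(t) = 0` (index `0 ∉ ℤ*` unused); `deBruijnZero t j = 0` if `H_t` has fewer than `j` positive
zeros (impossible for `t > Λ`); `1/0 = 0`, `Real.log 0 = 0` (coincident zeros — impossible for
`t > Λ`, `j ≠ k`); `zeroVelocitySum` is a `limUnder` (arbitrary if the principal value diverges — it
converges for `t > Λ`, `k ∈ ℤ*`, by `rodgers_tao_zero_dynamics`); `tsum = 0` when not summable
(every fact asserts summability).

## References

* B. Rodgers, T. Tao, *The de Bruijn–Newman constant is non-negative*, Forum Math. Pi 8 (2020)
  e6, §1.2 (p. 7: `ℤ*`, `x_{−j} = −x_j`, `[j₋, j₊]_{ℤ*}`, principal value sums), §4 (Thm. 11 p. 27,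
  (56); (57), (58) p. 29; Lemma 12 pp. 29–30; proof pp. 31–33) = arXiv:1801.05914v4/v5 Thm. 4.1,
  Lemma 4.2.
* G. Csordas, W. Smith, R. S. Varga, *Lehmer pairs of zeros, the de Bruijn–Newman constant `Λ`,
  and the Riemann Hypothesis*, Constr. Approx. 10 (1994), 107–129, Lemmas 2.1, 2.4, 2.5 (as cited
  by the source; text not held, cite-only).
-/

noncomputable section

open Filter Set Topology MeasureTheory

namespace Literature.NumberTheory.LFunctions

/-! ## The zeros indexed by `ℤ* = ℤ ∖ {0}` (§1.2) -/

/-- `x_j(t)` for `j ∈ ℤ`: the odd extension `x_{−j}(t) = −x_j(t)` of the tree's enumeration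
`deBruijnZero t j` (`j ≥ 1`) of the positive real zeros of `H_t` (Rodgers–Tao 2020, §1.2, FMP
p. 7: "we can express the zeroes of `H_t` as `(x_j(t))_{j ∈ ℤ*}`, where `ℤ* := ℤ ∖ {0}`, …,
`0 < x_1(t) < x_2(t) < …`, and `x_{−j}(t) = −x_j(t)` for all `j ≥ 1`"). Realised as
`sign(j) · x_{|j|}(t)`; the unused index `0` gets `x_0(t) = 0`.
[cite: RodgersTaoFMP2020, §1.2 p. 7] -/
def deBruijnZeroZ (t : ℝ) (j : ℤ) : ℝ :=
  (j.sign : ℝ) * deBruijnZero t j.natAbs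

/-- Unfolding lemma for `deBruijnZeroZ` (`x_j = sign(j) · x_{|j|}`, §1.2).
[cite: RodgersTaoFMP2020, §1.2 p. 7] -/
theorem deBruijnZeroZ_eq (t : ℝ) (j : ℤ) :
    deBruijnZeroZ t j = (j.sign : ℝ) * deBruijnZero t j.natAbs := rfl

/-- On natural indices the `ℤ`-indexed zeros are the tree's `x_j(t)`: `x_{(n : ℤ)} = x_n`
(including `x_0 = 0`). [cite: RodgersTaoFMP2020, §1.2 p. 7] -/
@[simp] theorem deBruijnZeroZ_natCast (t : ℝ) (n : ℕ) : deBruijnZeroZ t n = deBruijnZero t n := by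
  rcases Nat.eq_zero_or_pos n with rfl | hn
  · simp [deBruijnZeroZ]
  · rw [deBruijnZeroZ, Int.natAbs_natCast, Int.sign_natCast_of_ne_zero hn.ne']
    simp

/-- `x_0(t) = 0` (the index `0` is not in `ℤ*`; convention of this file, cf. `deBruijnZero_zero`).
[cite: RodgersTaoFMP2020, §1.2 p. 7] -/
@[simp] theorem deBruijnZeroZ_zero (t : ℝ) : deBruijnZeroZ t 0 = 0 := by
  simp [deBruijnZeroZ]

/-- **`x_{−j}(t) = −x_j(t)`** (Rodgers–Tao 2020, §1.2). [cite: RodgersTaoFMP2020, §1.2 p. 7] -/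
@[simp] theorem deBruijnZeroZ_neg (t : ℝ) (j : ℤ) : deBruijnZeroZ t (-j) = -deBruijnZeroZ t j := by
  simp [deBruijnZeroZ, Int.sign_neg, Int.natAbs_neg]

/-- `x_{−n}(t) = −x_n(t)` for a natural index `n` (§1.2: "`x_{−j}(t) = −x_j(t)` for all `j ≥ 1`").
[cite: RodgersTaoFMP2020, §1.2 p. 7] -/
theorem deBruijnZeroZ_neg_natCast (t : ℝ) (n : ℕ) :
    deBruijnZeroZ t (-(n : ℤ)) = -deBruijnZero t n := by
  rw [deBruijnZeroZ_neg, deBruijnZeroZ_natCast]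

/-- `s ↦ x_j(s)` (`j ∈ ℤ`) is continuous at every `t > Λ` (from the tree's continuity half of
Thm. 4.1, `continuousAt_deBruijnZero`). [cite: RodgersTaoFMP2020, Thm. 11 p. 27] -/
theorem continuousAt_deBruijnZeroZ {t : ℝ} (hΛ : ∃ t₁ : ℝ, t₁ < t ∧ HasOnlyRealZeros (deBruijnH t₁))
    (j : ℤ) : ContinuousAt (fun s ↦ deBruijnZeroZ s j) t :=
  continuousAt_const.mul (continuousAt_deBruijnZero hΛ j.natAbs)

/-- **`⋯ < x_{−2}(t) < x_{−1}(t) < x_0 = 0 < x_1(t) < x_2(t) < ⋯`** for `t > Λ`: the `ℤ`-indexed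
zeros are strictly increasing (`strictMono_deBruijnZero` and oddness).
[cite: RodgersTaoFMP2020, §1.2 p. 7] -/
theorem strictMono_deBruijnZeroZ {t : ℝ} (hΛ : ∃ t₁ : ℝ, t₁ < t ∧ HasOnlyRealZeros (deBruijnH t₁)) :
    StrictMono (deBruijnZeroZ t) := by
  refine strictMono_int_of_lt_succ fun j ↦ ?_
  rcases le_or_gt 0 j with hj | hj
  · obtain ⟨n, rfl⟩ := Int.eq_ofNat_of_zero_le hj
    have h1 : (n : ℤ) + 1 = ((n + 1 : ℕ) : ℤ) := by push_cast; ring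
    rw [h1, deBruijnZeroZ_natCast, deBruijnZeroZ_natCast]
    exact strictMono_deBruijnZero hΛ (Nat.lt_succ_self n)
  · obtain ⟨m, hm⟩ := Int.eq_ofNat_of_zero_le (show (0 : ℤ) ≤ -j - 1 by omega)
    have h1 : j = -((m + 1 : ℕ) : ℤ) := by push_cast; omega
    have h2 : j + 1 = -((m : ℕ) : ℤ) := by omega
    rw [h2, h1, deBruijnZeroZ_neg_natCast, deBruijnZeroZ_neg_natCast, neg_lt_neg_iff]
    exact strictMono_deBruijnZero hΛ (Nat.lt_succ_self m)

/-- The `ℤ`-indexed zeros are pairwise distinct for `t > Λ`. [cite: RodgersTaoFMP2020, §1.2 p. 7] -/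
theorem deBruijnZeroZ_injective {t : ℝ} (hΛ : ∃ t₁ : ℝ, t₁ < t ∧ HasOnlyRealZeros (deBruijnH t₁)) :
    Function.Injective (deBruijnZeroZ t) :=
  (strictMono_deBruijnZeroZ hΛ).injective

/-- `x_k(t) − x_j(t) ≠ 0` for `j ≠ k` and `t > Λ` (the zeros are distinct: no denominator below
vanishes in the printed range). [cite: RodgersTaoFMP2020, §1.2 p. 7] -/
theorem deBruijnZeroZ_sub_ne_zero {t : ℝ} (hΛ : ∃ t₁ : ℝ, t₁ < t ∧ HasOnlyRealZeros (deBruijnH t₁))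
    {j k : ℤ} (hjk : j ≠ k) : deBruijnZeroZ t k - deBruijnZeroZ t j ≠ 0 :=
  sub_ne_zero.2 fun h ↦ hjk ((deBruijnZeroZ_injective hΛ) h).symm

/-- `x_j(t) ≠ 0` for `j ∈ ℤ*` and `t > Λ` ("the zeroes … avoid the origin").
[cite: RodgersTaoFMP2020, §1.2 p. 7] -/
theorem deBruijnZeroZ_ne_zero {t : ℝ} (hΛ : ∃ t₁ : ℝ, t₁ < t ∧ HasOnlyRealZeros (deBruijnH t₁))
    {j : ℤ} (hj : j ≠ 0) : deBruijnZeroZ t j ≠ 0 := by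
  rw [← deBruijnZeroZ_zero t]
  exact fun h ↦ hj (deBruijnZeroZ_injective hΛ h)

/-- `0 < x_j(t)` for `j ≥ 1` (`j : ℤ`) and `t > Λ`. [cite: RodgersTaoFMP2020, §1.2 p. 7] -/
theorem deBruijnZeroZ_pos {t : ℝ} (hΛ : ∃ t₁ : ℝ, t₁ < t ∧ HasOnlyRealZeros (deBruijnH t₁))
    {j : ℤ} (hj : 0 < j) : 0 < deBruijnZeroZ t j := by
  rw [← deBruijnZeroZ_zero t]
  exact strictMono_deBruijnZeroZ hΛ hj

/-- **`x_j(t)` is a zero of `H_t`** for every `j ∈ ℤ*` and `t > Λ` (`deBruijnH_deBruijnZero` and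
the evenness of `H_t`). [cite: RodgersTaoFMP2020, §1.2 p. 7] -/
theorem deBruijnH_deBruijnZeroZ {t : ℝ} (hΛ : ∃ t₁ : ℝ, t₁ < t ∧ HasOnlyRealZeros (deBruijnH t₁))
    {j : ℤ} (hj : j ≠ 0) : deBruijnH t (deBruijnZeroZ t j) = 0 := by
  rcases le_or_gt 0 j with h | h
  · obtain ⟨n, rfl⟩ := Int.eq_ofNat_of_zero_le h
    rw [deBruijnZeroZ_natCast]
    exact deBruijnH_deBruijnZero hΛ (by omega)
  · obtain ⟨n, hn⟩ := Int.eq_ofNat_of_zero_le (show (0 : ℤ) ≤ -j by omega)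
    have hj' : j = -(n : ℤ) := by omega
    rw [hj', deBruijnZeroZ_neg_natCast, Complex.ofReal_neg, deBruijnH_neg]
    exact deBruijnH_deBruijnZero hΛ (by omega)

/-- **Every real zero of `H_t` is an `x_j(t)`, `j ∈ ℤ*`** (`t > Λ`): the family
`(x_j(t))_{j ∈ ℤ*}` enumerates the zeros (`exists_deBruijnZero_eq_or_eq_neg`).
[cite: RodgersTaoFMP2020, §1.2 p. 7] -/
theorem exists_deBruijnZeroZ_eq {t : ℝ} (hΛ : ∃ t₁ : ℝ, t₁ < t ∧ HasOnlyRealZeros (deBruijnH t₁))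
    {x : ℝ} (hx : deBruijnH t x = 0) : ∃ j : ℤ, j ≠ 0 ∧ deBruijnZeroZ t j = x := by
  obtain ⟨n, hn, h⟩ := exists_deBruijnZero_eq_or_eq_neg hΛ hx
  rcases h with h | h
  · exact ⟨n, by omega, by rw [deBruijnZeroZ_natCast, h]⟩
  · exact ⟨-(n : ℤ), by omega, by rw [deBruijnZeroZ_neg_natCast, h, neg_neg]⟩

/-- Every zero `z ∈ ℂ` of `H_t` (`t > Λ`) is `x_j(t)` for some `j ∈ ℤ*`.
[cite: RodgersTaoFMP2020, §1.2 p. 7] -/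
theorem exists_deBruijnZeroZ_eq_of_zero {t : ℝ}
    (hΛ : ∃ t₁ : ℝ, t₁ < t ∧ HasOnlyRealZeros (deBruijnH t₁)) {z : ℂ} (hz : deBruijnH t z = 0) :
    ∃ j : ℤ, j ≠ 0 ∧ (deBruijnZeroZ t j : ℂ) = z := by
  have him : z.im = 0 := hasOnlyRealZeros_of_exists_lt hΛ z hz
  have hzre : (z.re : ℂ) = z := by apply Complex.ext <;> simp [him]
  obtain ⟨j, hj, h⟩ := exists_deBruijnZeroZ_eq hΛ (x := z.re) (by rw [hzre]; exact hz)
  exact ⟨j, hj, by rw [h, hzre]⟩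

/-- **The zeros `x_j(t)`, `j ∈ ℤ*`, are simple** (`t > Λ`): `H_t'(x_j(t)) ≠ 0` (Csordas–Smith–Varga
Thm. 2.2, `csordasSmithVarga_simple_zeros_holds`). [cite: RodgersTaoFMP2020, §1.2 p. 7] -/
theorem deriv_deBruijnH_deBruijnZeroZ_ne_zero {t : ℝ}
    (hΛ : ∃ t₁ : ℝ, t₁ < t ∧ HasOnlyRealZeros (deBruijnH t₁)) {j : ℤ} (hj : j ≠ 0) :
    deriv (deBruijnH t) (deBruijnZeroZ t j) ≠ 0 := by
  obtain ⟨t₁, ht₁, hreal⟩ := hΛ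
  exact csordasSmithVarga_simple_zeros_holds t₁ t ht₁ hreal _
    (deBruijnH_deBruijnZeroZ ⟨t₁, ht₁, hreal⟩ hj)

/-! ## Discrete intervals and principal value sums (§1.2) -/

/-- The discrete interval `[a, b]_{ℤ*} := {j ∈ ℤ* : a ≤ j ≤ b}` (Rodgers–Tao 2020, §1.2, FMP
p. 7; the source allows real endpoints `j₋ ≤ j₊`, only integer ones are needed in §4).
[cite: RodgersTaoFMP2020, §1.2 p. 7] -/
def zstarIcc (a b : ℤ) : Finset ℤ :=
  (Finset.Icc a b).filter (· ≠ 0)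

/-- Membership in `[a, b]_{ℤ*}`: `j ∈ [a, b]_{ℤ*} ↔ j ∈ ℤ* ∧ a ≤ j ≤ b` (the printed definition,
§1.2). [cite: RodgersTaoFMP2020, §1.2 p. 7] -/
@[simp] theorem mem_zstarIcc {a b j : ℤ} : j ∈ zstarIcc a b ↔ j ≠ 0 ∧ a ≤ j ∧ j ≤ b := by
  simp [zstarIcc, and_comm, and_assoc]

/-- `0 ∉ [a, b]_{ℤ*}` (`ℤ* = ℤ ∖ {0}`, §1.2). [cite: RodgersTaoFMP2020, §1.2 p. 7] -/
theorem zero_notMem_zstarIcc (a b : ℤ) : (0 : ℤ) ∉ zstarIcc a b := by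
  simp

/-- The index set `ℤ* ∖ K` of the "environment" of a finite set `K ⊂ ℤ*` of indices (the range
of the summation variable `j ∉ K` — resp. `i ≠ k, j`, i.e. `K = {k, j}` — in Lemma 12, all
indices being in `ℤ*`). [cite: RodgersTaoFMP2020, Lemma 12 p. 29] -/
def zstarCompl (K : Finset ℤ) : Set ℤ :=
  {j : ℤ | j ≠ 0 ∧ j ∉ K}

/-- Membership in `ℤ* ∖ K`: `j ≠ 0 ∧ j ∉ K` ("all summation indices … lie in `ℤ*`", Lemma 12).
[cite: RodgersTaoFMP2020, Lemma 12 p. 29] -/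
@[simp] theorem mem_zstarCompl {K : Finset ℤ} {j : ℤ} : j ∈ zstarCompl K ↔ j ≠ 0 ∧ j ∉ K :=
  Iff.rfl

/-- The partial sums `Σ_{j ∈ [−J, J]_{ℤ*}, j ≠ k} 1/(x_k(t) − x_j(t))` of the principal value sum
in (56) (Rodgers–Tao 2020, §1.2, FMP p. 7: "We will use a marked sum to indicate principal
value summation: `Σ'_j ⋯ = lim_{J → ∞} Σ_{|j| ≤ J} ⋯`"; all indices in `ℤ*`).
[cite: RodgersTaoFMP2020, §1.2 p. 7] -/
def zeroVelocityPartialSum (t : ℝ) (k : ℤ) (J : ℕ) : ℝ :=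
  ∑ j ∈ (zstarIcc (-(J : ℤ)) J).erase k, 1 / (deBruijnZeroZ t k - deBruijnZeroZ t j)

/-- Unfolding lemma for `zeroVelocityPartialSum` (the truncation `Σ_{|j| ≤ J}` of §1.2).
[cite: RodgersTaoFMP2020, §1.2 p. 7] -/
theorem zeroVelocityPartialSum_eq (t : ℝ) (k : ℤ) (J : ℕ) :
    zeroVelocityPartialSum t k J =
      ∑ j ∈ (zstarIcc (-(J : ℤ)) J).erase k, 1 / (deBruijnZeroZ t k - deBruijnZeroZ t j) := rfl

/-- The principal value sum
`Σ'_{j : j ≠ k} 1/(x_k(t) − x_j(t)) = lim_{J → ∞} Σ_{j ∈ [−J,J]_{ℤ*}, j ≠ k} 1/(x_k(t) − x_j(t))`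
of (56) (Rodgers–Tao 2020, Thm. 11, FMP p. 27, with the principal value
convention of §1.2, p. 7). Realised with `limUnder atTop`: an arbitrary real number if the
partial sums do not converge; they do for `t > Λ`, `k ∈ ℤ*` ("which will converge thanks to (50)
and (43)") — this convergence is part of the named fact `rodgers_tao_zero_dynamics`, after which
`tendsto_zeroVelocityPartialSum_zeroVelocitySum` identifies the value.
[cite: RodgersTaoFMP2020, Thm. 11 p. 27 (56)] -/
def zeroVelocitySum (t : ℝ) (k : ℤ) : ℝ :=
  limUnder atTop (zeroVelocityPartialSum t k)

/-- If the principal value converges to `v`, then `zeroVelocitySum t k = v` (the `lim_{J → ∞}` of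
§1.2 is the value of `Σ'`). [cite: RodgersTaoFMP2020, §1.2 p. 7] -/
theorem zeroVelocitySum_eq_of_tendsto {t : ℝ} {k : ℤ} {v : ℝ}
    (h : Tendsto (zeroVelocityPartialSum t k) atTop (𝓝 v)) : zeroVelocitySum t k = v :=
  h.limUnder_eq

/-- If the principal value converges at all, it converges to `zeroVelocitySum t k` (§1.2,
`Σ' = lim_{J → ∞} Σ_{|j| ≤ J}`). [cite: RodgersTaoFMP2020, §1.2 p. 7] -/
theorem tendsto_zeroVelocityPartialSum_zeroVelocitySum {t : ℝ} {k : ℤ}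
    (h : ∃ v : ℝ, Tendsto (zeroVelocityPartialSum t k) atTop (𝓝 v)) :
    Tendsto (zeroVelocityPartialSum t k) atTop (𝓝 (zeroVelocitySum t k)) :=
  tendsto_nhds_limUnder h

/-! ## The interaction energy `E_{jk}` (58) and the Hamiltonian interaction `H_{jk}` (57) -/

/-- The interaction energy `E_{jk}(t) := 1/|x_j(t) − x_k(t)|²` between the zeros `x_j(t)` and
`x_k(t)`, `j, k ∈ ℤ*` (Rodgers–Tao 2020, §4, display (58), FMP p. 29). Junk `0` if
`x_j(t) = x_k(t)` (`1/0 = 0`; impossible for `j ≠ k`, `t > Λ`).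
[cite: RodgersTaoFMP2020, §4 p. 29 (58)] -/
def interactionEnergy (t : ℝ) (j k : ℤ) : ℝ :=
  1 / (deBruijnZeroZ t j - deBruijnZeroZ t k) ^ 2

/-- Unfolding lemma for `E_{jk}` (display (58)). [cite: RodgersTaoFMP2020, §4 p. 29 (58)] -/
theorem interactionEnergy_eq (t : ℝ) (j k : ℤ) :
    interactionEnergy t j k = 1 / (deBruijnZeroZ t j - deBruijnZeroZ t k) ^ 2 := rfl

/-- `E_{jk} = E_{kj}` (display (58) is symmetric: `1/|x_k − x_{k'}|²`).
[cite: RodgersTaoFMP2020, §4 p. 29 (58)] -/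
theorem interactionEnergy_comm (t : ℝ) (j k : ℤ) :
    interactionEnergy t j k = interactionEnergy t k j := by
  rw [interactionEnergy, interactionEnergy, ← neg_sub, neg_sq]

/-- `E_{jk} ≥ 0` (display (58); always, including the junk case).
[cite: RodgersTaoFMP2020, §4 p. 29 (58)] -/
theorem interactionEnergy_nonneg (t : ℝ) (j k : ℤ) : 0 ≤ interactionEnergy t j k := by
  rw [interactionEnergy]; positivity

/-- `E_{jk}(t) > 0` for `j ≠ k` and `t > Λ`. [cite: RodgersTaoFMP2020, §4 p. 29 (58)] -/
theorem interactionEnergy_pos {t : ℝ} (hΛ : ∃ t₁ : ℝ, t₁ < t ∧ HasOnlyRealZeros (deBruijnH t₁))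
    {j k : ℤ} (hjk : j ≠ k) : 0 < interactionEnergy t j k := by
  rw [interactionEnergy]
  have h := deBruijnZeroZ_sub_ne_zero hΛ hjk.symm
  positivity

/-- The Hamiltonian interaction `H_{jk}(t) := log (1/|x_j(t) − x_k(t)|)` between `x_j(t)` and
`x_k(t)`, `j, k ∈ ℤ*` (Rodgers–Tao 2020, §4, display (57), FMP p. 29). Junk `0` if
`x_j(t) = x_k(t)` (`1/0 = 0`, `log 0 = 0`; impossible for `j ≠ k`, `t > Λ`).
[cite: RodgersTaoFMP2020, §4 p. 29 (57)] -/
def hamiltonianInteraction (t : ℝ) (j k : ℤ) : ℝ :=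
  Real.log (1 / |deBruijnZeroZ t j - deBruijnZeroZ t k|)

/-- Unfolding lemma for `H_{jk}` (display (57)). [cite: RodgersTaoFMP2020, §4 p. 29 (57)] -/
theorem hamiltonianInteraction_eq (t : ℝ) (j k : ℤ) :
    hamiltonianInteraction t j k = Real.log (1 / |deBruijnZeroZ t j - deBruijnZeroZ t k|) := rfl

/-- `H_{jk} = −log |x_j − x_k|` (display (57): `log (1/|x_j − x_k|)`).
[cite: RodgersTaoFMP2020, §4 p. 29 (57)] -/
theorem hamiltonianInteraction_eq_neg_log (t : ℝ) (j k : ℤ) :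
    hamiltonianInteraction t j k = -Real.log |deBruijnZeroZ t j - deBruijnZeroZ t k| := by
  rw [hamiltonianInteraction, one_div, Real.log_inv]

/-- `H_{jk} = H_{kj}` (display (57) is symmetric). [cite: RodgersTaoFMP2020, §4 p. 29 (57)] -/
theorem hamiltonianInteraction_comm (t : ℝ) (j k : ℤ) :
    hamiltonianInteraction t j k = hamiltonianInteraction t k j := by
  rw [hamiltonianInteraction, hamiltonianInteraction, abs_sub_comm]

/-! ## The environment coupling `Σ_{j ∉ K} 1/((x_j − x_k)(x_j − x_{k'}))` of Lemma 12 -/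

/-- The summand `1/((x_j(t) − x_k(t))(x_j(t) − x_{k'}(t)))` of the sums over the environment index
`j ∉ K` (resp. `i ≠ k, j`) in Lemma 12 (i), (iii), (iv), (v) (Rodgers–Tao 2020, FMP p. 30; note
`(x_k − x_j)(x_{k'} − x_j) = (x_j − x_k)(x_j − x_{k'})`). Junk `0` at a coincidence (`1/0 = 0`).
[cite: RodgersTaoFMP2020, Lemma 12 p. 30] -/
def rodgersTaoCrossTerm (t : ℝ) (k k' j : ℤ) : ℝ :=
  1 / ((deBruijnZeroZ t j - deBruijnZeroZ t k) * (deBruijnZeroZ t j - deBruijnZeroZ t k'))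

/-- Unfolding lemma for `rodgersTaoCrossTerm` (the summand printed in Lemma 12 (v)).
[cite: RodgersTaoFMP2020, Lemma 12 p. 30] -/
theorem rodgersTaoCrossTerm_eq (t : ℝ) (k k' j : ℤ) :
    rodgersTaoCrossTerm t k k' j =
      1 / ((deBruijnZeroZ t j - deBruijnZeroZ t k) *
        (deBruijnZeroZ t j - deBruijnZeroZ t k')) := rfl

/-- `rodgersTaoCrossTerm` is symmetric in the pair `k, k'` (Lemma 12, the summand
`1/((x_j − x_k)(x_j − x_{k'}))`). [cite: RodgersTaoFMP2020, Lemma 12 p. 30] -/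
theorem rodgersTaoCrossTerm_comm (t : ℝ) (k k' j : ℤ) :
    rodgersTaoCrossTerm t k k' j = rodgersTaoCrossTerm t k' k j := by
  rw [rodgersTaoCrossTerm, rodgersTaoCrossTerm, mul_comm]

/-- The environment coupling `Σ_{j ∈ ℤ* ∖ K} 1/((x_j(t) − x_k(t))(x_j(t) − x_{k'}(t)))` of the pair
`k, k'` (Rodgers–Tao 2020, Lemma 12 (iii)–(v), FMP p. 30, inner sums "`Σ_{j ∉ K}`"; in (i) with
`K = {k, j}`: "`Σ_{i : i ≠ k, j}`"), as a `tsum` over the subtype `zstarCompl K` (junk `0` if not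
summable; the facts below assert summability, which the source notes: "the series is now
absolutely convergent thanks to (50), (43)", p. 31). [cite: RodgersTaoFMP2020, Lemma 12 p. 30] -/
def rodgersTaoCrossSum (t : ℝ) (K : Finset ℤ) (k k' : ℤ) : ℝ :=
  ∑' j : zstarCompl K, rodgersTaoCrossTerm t k k' j

/-- Unfolding lemma for `rodgersTaoCrossSum` (the inner sums `Σ_{j ∉ K}` of Lemma 12).
[cite: RodgersTaoFMP2020, Lemma 12 p. 30] -/
theorem rodgersTaoCrossSum_eq (t : ℝ) (K : Finset ℤ) (k k' : ℤ) :
    rodgersTaoCrossSum t K k k' = ∑' j : zstarCompl K, rodgersTaoCrossTerm t k k' j := rfl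

/-- `rodgersTaoCrossSum` is symmetric in the pair `k, k'` (Lemma 12).
[cite: RodgersTaoFMP2020, Lemma 12 p. 30] -/
theorem rodgersTaoCrossSum_comm (t : ℝ) (K : Finset ℤ) (k k' : ℤ) :
    rodgersTaoCrossSum t K k k' = rodgersTaoCrossSum t K k' k := by
  simp only [rodgersTaoCrossSum, rodgersTaoCrossTerm_comm t k k']

end Literature.NumberTheory.LFunctions

/-! ## Named facts: Theorem 11 (= 4.1) and Lemma 12 (= 4.2) (i)–(v) -/

namespace Literature.NumberTheory.LFunctions

/-- RH-FREE — NAMED FACT. Rodgers–Tao 2020, **Theorem 11** (= arXiv v4 Thm. 4.1, Dynamics of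
zeros; FMP p. 27, display (56); after Csordas–Smith–Varga 1994, Lemmas 2.1 and 2.4): «For
`Λ < t ≤ 0`, the zeroes `x_j(t)` depend in a continuously differentiable fashion on `t` for each
`j`, with the equations of motion `∂ₜ x_k(t) = 2 Σ'_{j : j ≠ k} 1/(x_k(t) − x_j(t))` (56) for
`k ∈ ℤ*` and `Λ < t ≤ 0`, where recall the tick denotes principal value summation over `j ∈ ℤ*`
(which will converge thanks to (50) and (43)).» Typed: for every `t > Λ` (`sInf`-free: `H_{t₁}`
real-rooted for some `t₁ < t`) and every `k ∈ ℤ*`: (a) `s ↦ x_k(s)` is `C¹` at `t`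
(`ContDiffAt ℝ 1`); (b) the principal value partial sums over `[−J, J]_{ℤ*} ∖ {k}` converge as
`J → ∞` (to `zeroVelocitySum t k`); (c) `s ↦ x_k(s)` has derivative `2 · zeroVelocitySum t k`
at `t`.
Typed range: `t > Λ` (printed: `Λ < t ≤ 0`; the bound `t ≤ 0` is the standing range of §1.2 and
is not used by the derivation — real simple zeros (`csordasSmithVarga_simple_zeros_holds`),
Hadamard product (`exists_isHadamardSeq`) and heat equation (`hasDerivAt_deBruijnH_time`) hold for
all `t > Λ`; README §0.4 / RT Remark 2.2). Divergence: none otherwise (arXiv v1/v2 misprint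
"`−Λ < t ≤ 0`" not followed). The continuity-in-`t` and ordering part is the tree theorem
`continuousAt_deBruijnZero` / `strictMono_deBruijnZero`. Users take
`(h : rodgers_tao_zero_dynamics)`. [cite: RodgersTaoFMP2020, Thm. 11 p. 27 (56)] -/
def rodgers_tao_zero_dynamics : Prop :=
  ∀ t : ℝ, (∃ t₁ : ℝ, t₁ < t ∧ HasOnlyRealZeros (deBruijnH t₁)) → ∀ k : ℤ, k ≠ 0 →
    ContDiffAt ℝ 1 (fun s ↦ deBruijnZeroZ s k) t ∧
      Tendsto (zeroVelocityPartialSum t k) atTop (𝓝 (zeroVelocitySum t k)) ∧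
      HasDerivAt (fun s ↦ deBruijnZeroZ s k) (2 * zeroVelocitySum t k) t

/-- RH-FREE — NAMED FACT. Rodgers–Tao 2020, **Lemma 12 (i)** (= arXiv v4 Lemma 4.2 (i), Dynamics
of a gap, cf. Csordas–Smith–Varga 1994 Lemma 2.4; FMP p. 30): «If `j, k ∈ ℤ*` are distinct, then
`∂ₜ(x_k − x_j) = 4/(x_k − x_j) − 2(x_k − x_j) Σ_{i : i ≠ k,j} 1/((x_i − x_k)(x_i − x_j))`», the time
`t ∈ (Λ, 0]` being suppressed and all indices lying in `ℤ*`; proof p. 31: «Note that the series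
is now absolutely convergent thanks to (50), (43).» Typed: for every `t > Λ` (`sInf`-free) and
distinct `j, k ∈ ℤ*`, the series `Σ_{i ∈ ℤ* ∖ {k, j}} 1/((x_i − x_k)(x_i − x_j))` is summable
(`rodgersTaoCrossTerm` / `rodgersTaoCrossSum` with `K = {k, j}`) and `s ↦ x_k(s) − x_j(s)` has
the displayed derivative at `t`. Typed range: `t > Λ` (printed `t ∈ (Λ, 0]`; README §0.4).
Divergence: none otherwise. Users take `(h : rodgers_tao_gap_dynamics)`.
[cite: RodgersTaoFMP2020, Lemma 12 (i) p. 30] -/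
def rodgers_tao_gap_dynamics : Prop :=
  ∀ t : ℝ, (∃ t₁ : ℝ, t₁ < t ∧ HasOnlyRealZeros (deBruijnH t₁)) → ∀ j k : ℤ, j ≠ 0 → k ≠ 0 → j ≠ k →
    Summable (fun i : zstarCompl {k, j} ↦ rodgersTaoCrossTerm t k j i) ∧
      HasDerivAt (fun s ↦ deBruijnZeroZ s k - deBruijnZeroZ s j)
        (4 / (deBruijnZeroZ t k - deBruijnZeroZ t j) -
          2 * (deBruijnZeroZ t k - deBruijnZeroZ t j) * rodgersTaoCrossSum t {k, j} k j) t

/-- RH-FREE — NAMED FACT. Rodgers–Tao 2020, **Lemma 12 (ii)** (= arXiv v4 Lemma 4.2 (ii),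
Cross-energy inequality, cf. Csordas–Smith–Varga 1994 Lemma 2.5; FMP p. 30): «One has
`∂ₜ Σ_{k ∈ K; j ∉ K} E_{jk} ≥ −Σ_{k ∈ K; j ∉ K} 8/(x_k − x_j)⁴` in the weak sense that
`Σ_{k ∈ K; j ∉ K} E_{jk}(t₂) − E_{jk}(t₁) ≥ −∫_{t₁}^{t₂} Σ_{k ∈ K; j ∉ K} 8/(x_k − x_j)⁴ (t) dt`
whenever `Λ < t₁ < t₂ ≤ 0`», for a finite `K ⊂ ℤ*`, all indices in `ℤ*`. Typed: for every finite
`K ⊂ ℤ*` (`0 ∉ K`) and `Λ < t₁ < t₂` (`sInf`-free: `H_{t₀}` real-rooted for some `t₀ < t₁`):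
the series `Σ_{j ∈ ℤ* ∖ K} E_{jk}(t)` and `Σ_{j ∈ ℤ* ∖ K} 8/(x_k(t) − x_j(t))⁴` are summable for
every `t ∈ [t₁, t₂]` and `k ∈ K`, the integrand `t ↦ Σ_{k ∈ K} Σ_{j ∈ ℤ* ∖ K} 8/(x_k − x_j)⁴` is
interval-integrable on `[t₁, t₂]`, and the displayed inequality holds. Typed range: `Λ < t₁ < t₂`
(printed `Λ < t₁ < t₂ ≤ 0`; README §0.4). Divergence: the summability / integrability clauses
are implicit in the source (its proof, p. 31, passes to the limit `R → ∞` in the truncations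
`j ∈ [−R, R]_{ℤ*} ∖ K` by monotone convergence) and are stated so that `∑'` and `∫` carry no
junk values. Users take `(h : rodgers_tao_cross_energy_inequality)`.
[cite: RodgersTaoFMP2020, Lemma 12 (ii) p. 30] -/
def rodgers_tao_cross_energy_inequality : Prop :=
  ∀ K : Finset ℤ, (0 : ℤ) ∉ K → ∀ t₁ t₂ : ℝ,
    (∃ t₀ : ℝ, t₀ < t₁ ∧ HasOnlyRealZeros (deBruijnH t₀)) → t₁ < t₂ →
    (∀ t ∈ Icc t₁ t₂, ∀ k ∈ K,
        Summable (fun j : zstarCompl K ↦ interactionEnergy t j k) ∧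
        Summable (fun j : zstarCompl K ↦ 8 / (deBruijnZeroZ t k - deBruijnZeroZ t j) ^ 4)) ∧
      IntervalIntegrable
        (fun t ↦ ∑ k ∈ K, ∑' j : zstarCompl K, 8 / (deBruijnZeroZ t k - deBruijnZeroZ t j) ^ 4)
        volume t₁ t₂ ∧
      -(∫ t in t₁..t₂, ∑ k ∈ K, ∑' j : zstarCompl K,
            8 / (deBruijnZeroZ t k - deBruijnZeroZ t j) ^ 4) ≤
        ∑ k ∈ K, ∑' j : zstarCompl K, (interactionEnergy t₂ j k - interactionEnergy t₁ j k)

/-- RH-FREE — NAMED FACT. Rodgers–Tao 2020, **Lemma 12 (iii)** (= arXiv v4 Lemma 4.2 (iii),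
Energy identity; FMP p. 30): «`∂ₜ Σ_{k,k' ∈ K : k ≠ k'} E_{kk'} =
Σ_{j ∉ K; k,k' ∈ K : k ≠ k'} 4/((x_k − x_{k'})²(x_k − x_j)(x_{k'} − x_j))
− 2 Σ_{k,k' ∈ K : k ≠ k'} (2/(x_k − x_{k'})² − Σ_{k'' ∈ K : k'' ≠ k,k'} 1/((x_{k''} − x_k)(x_{k''} − x_{k'})))²`»,
for a finite `K ⊂ ℤ*`, the time `t ∈ (Λ, 0]` suppressed, all indices in `ℤ*`. Typed: for every
`t > Λ` (`sInf`-free) and finite `K ⊂ ℤ*` (`0 ∉ K`): for each ordered pair `k ≠ k'` in `K`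
(`K.offDiag`) the environment series `Σ_{j ∈ ℤ* ∖ K} 1/((x_j − x_k)(x_j − x_{k'}))` is summable
(`rodgersTaoCrossSum t K k k'`; note `(x_k − x_j)(x_{k'} − x_j) = (x_j − x_k)(x_j − x_{k'})`), and
`s ↦ Σ_{(k,k') ∈ K.offDiag} E_{kk'}(s)` has derivative
`Σ_{(k,k')} (4/(x_k − x_{k'})²) · rodgersTaoCrossSum t K k k' − 2 Σ_{(k,k')} (2/(x_k − x_{k'})² −
Σ_{k'' ∈ K ∖ {k,k'}} 1/((x_{k''} − x_k)(x_{k''} − x_{k'})))²` at `t`. Typed range: `t > Λ`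
(printed `t ∈ (Λ, 0]`; README §0.4). Divergence: the printed double sum `Σ_{j ∉ K; k ≠ k'}` is
rendered as the finite sum over pairs of the (summable) series in `j`. Users take
`(h : rodgers_tao_energy_identity)`. [cite: RodgersTaoFMP2020, Lemma 12 (iii) p. 30] -/
def rodgers_tao_energy_identity : Prop :=
  ∀ t : ℝ, (∃ t₁ : ℝ, t₁ < t ∧ HasOnlyRealZeros (deBruijnH t₁)) → ∀ K : Finset ℤ, (0 : ℤ) ∉ K →
    (∀ p ∈ K.offDiag, Summable (fun j : zstarCompl K ↦ rodgersTaoCrossTerm t p.1 p.2 j)) ∧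
      HasDerivAt (fun s ↦ ∑ p ∈ K.offDiag, interactionEnergy s p.1 p.2)
        ((∑ p ∈ K.offDiag,
            4 / (deBruijnZeroZ t p.1 - deBruijnZeroZ t p.2) ^ 2 * rodgersTaoCrossSum t K p.1 p.2) -
          2 * ∑ p ∈ K.offDiag,
            (2 / (deBruijnZeroZ t p.1 - deBruijnZeroZ t p.2) ^ 2 -
              ∑ i ∈ (K.erase p.1).erase p.2,
                1 / ((deBruijnZeroZ t i - deBruijnZeroZ t p.1) *
                  (deBruijnZeroZ t i - deBruijnZeroZ t p.2))) ^ 2)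
        t

/-- RH-FREE — NAMED FACT. Rodgers–Tao 2020, **Lemma 12 (iv)** (= arXiv v4 Lemma 4.2 (iv), Virial
identity; FMP p. 30): «`∂ₜ Σ_{k,k' ∈ K : k ≠ k'} (x_k − x_{k'})² = 4|K|²(|K| − 1)
− Σ_{k,k' ∈ K : k ≠ k'} (x_k − x_{k'})² Σ_{j ∉ K} 4/((x_k − x_j)(x_{k'} − x_j))`», for a finite
`K ⊂ ℤ*` of cardinality `|K|`, the time `t ∈ (Λ, 0]` suppressed, all indices in `ℤ*`. Typed: for
every `t > Λ` (`sInf`-free) and finite `K ⊂ ℤ*` (`0 ∉ K`): for each ordered pair `k ≠ k'` in `K`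
the environment series is summable (`rodgersTaoCrossSum t K k k'`), and
`s ↦ Σ_{(k,k') ∈ K.offDiag} (x_k(s) − x_{k'}(s))²` has derivative
`4 |K|² (|K| − 1) − Σ_{(k,k')} (x_k − x_{k'})² · 4 · rodgersTaoCrossSum t K k k'` at `t` (`|K|`
cast to `ℝ` before subtracting). Typed range: `t > Λ` (printed `t ∈ (Λ, 0]`; README §0.4).
Divergence: none otherwise. Users take `(h : rodgers_tao_virial_identity)`.
[cite: RodgersTaoFMP2020, Lemma 12 (iv) p. 30] -/
def rodgers_tao_virial_identity : Prop :=
  ∀ t : ℝ, (∃ t₁ : ℝ, t₁ < t ∧ HasOnlyRealZeros (deBruijnH t₁)) → ∀ K : Finset ℤ, (0 : ℤ) ∉ K →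
    (∀ p ∈ K.offDiag, Summable (fun j : zstarCompl K ↦ rodgersTaoCrossTerm t p.1 p.2 j)) ∧
      HasDerivAt (fun s ↦ ∑ p ∈ K.offDiag, (deBruijnZeroZ s p.1 - deBruijnZeroZ s p.2) ^ 2)
        (4 * (K.card : ℝ) ^ 2 * ((K.card : ℝ) - 1) -
          ∑ p ∈ K.offDiag,
            (deBruijnZeroZ t p.1 - deBruijnZeroZ t p.2) ^ 2 * (4 * rodgersTaoCrossSum t K p.1 p.2))
        t

/-- RH-FREE — NAMED FACT. Rodgers–Tao 2020, **Lemma 12 (v)** (= arXiv v4 Lemma 4.2 (v),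
Hamiltonian identity; FMP p. 30): «`∂ₜ Σ_{k,k' ∈ K : k ≠ k'} H_{kk'} = −4 Σ_{k,k' ∈ K : k ≠ k'} E_{kk'}
+ 2 Σ_{j ∉ K; k,k' ∈ K : k ≠ k'} 1/((x_j − x_k)(x_j − x_{k'}))`», for a finite `K ⊂ ℤ*`, the time
`t ∈ (Λ, 0]` suppressed, all indices in `ℤ*`. Typed: for every `t > Λ` (`sInf`-free) and finite
`K ⊂ ℤ*` (`0 ∉ K`): for each ordered pair `k ≠ k'` in `K` the environment series is summable, and
`s ↦ Σ_{(k,k') ∈ K.offDiag} H_{kk'}(s)` has derivative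
`−4 Σ_{(k,k')} E_{kk'}(t) + 2 Σ_{(k,k')} rodgersTaoCrossSum t K k k'` at `t`. Typed range: `t > Λ`
(printed `t ∈ (Λ, 0]`; README §0.4). Divergence: the printed double sum `Σ_{j ∉ K; k ≠ k'}` is
rendered as the finite sum over pairs of the (summable) series in `j`. Users take
`(h : rodgers_tao_hamiltonian_identity)`. [cite: RodgersTaoFMP2020, Lemma 12 (v) p. 30] -/
def rodgers_tao_hamiltonian_identity : Prop :=
  ∀ t : ℝ, (∃ t₁ : ℝ, t₁ < t ∧ HasOnlyRealZeros (deBruijnH t₁)) → ∀ K : Finset ℤ, (0 : ℤ) ∉ K →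
    (∀ p ∈ K.offDiag, Summable (fun j : zstarCompl K ↦ rodgersTaoCrossTerm t p.1 p.2 j)) ∧
      HasDerivAt (fun s ↦ ∑ p ∈ K.offDiag, hamiltonianInteraction s p.1 p.2)
        (-4 * ∑ p ∈ K.offDiag, interactionEnergy t p.1 p.2 +
          2 * ∑ p ∈ K.offDiag, rodgersTaoCrossSum t K p.1 p.2)
        t

end Literature.NumberTheory.LFunctions

end
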